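import Summits.AtomisticToContinuum.Crystallization.Theorems.FrustratedLawDichotomyStrainedPatchHomSlopeLJ

/-!
# The AFFINE-REFERENCE (sheet-tracking) centred slope leaf of the pure Lennard-Jones profile: the reference force bound `f₀` along `ξ₀(U) = ξ_c + J·(U − U_c)`
# (27623 `(H) HomFloor (1/625)`, hcp half; critic row 1284 «hand-1 g34: sheet-tracking confined box = the lever to type»; hand-1 g33 FINDING §5 (K1))

decomp-a2c hand-1 g34 (crux `AperiodicFrustratedLawGap`, stmt-AtomisticToContinuum-27623).  KERNEL DIAGNOSIS OF RECORD (hand-1 g33 `…HTUWideCell`/`…HTUBulkCells`):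
the product slab leaf fixes ONE reference shuffle `ξ₀ = ξ_c` per entry cell, so its reference force bound `Gs` (hence the slab constant and the confined shuffle box)
grows linearly with the cell width because the force-free sheet `ξ⋆(U)` TILTS across the cell.  This file is the slope leaf of `…HomSlopeLJ` along an AFFINE
reference `ξ₀(U)_m = c_m/SC + Σ_kl (J_m,kl/SC)(U_kl − c_kl/SC)` (payload `J`, scaled; the driver takes `J ≈ dξ⋆/dU`):

* §1 `affShuf J c U` (the affine reference), `jw` / `hullW` (the product HULL of the affine graph over the entry box: entry half-widths `w`, shuffle
  half-widths `⌈Σ_kl |J_m,kl| w_kl / SC⌉`), ★ `abs_affShuf_sub_le` (the graph lies in the hull), `cJ`/`cJr` (the `D_kl`-coefficient `Σ_m (c_km/SC)(J_m,kl/SC)`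
  of the shift `(U_c(ξ₀(U) − ξ_c))_k`), ★ `shift_affine_decomp` (`(U(ξ₀(U) − ξ_c))_k = Σ_kl D_kl·cJr_k,kl + s_k`, `|s_k|·SC ≤ ubA_k` — the second-order residual);
* §2 kernel: the first-order array `MarrLJA` = `…HomSlopeLJ.MarrLJ` with the `J`-transported shift term `Σ_k' cJ_k',kl·h⁰_b,k'i` added INSIDE the label
  accumulation (the cancellation `∂_U F + H_F·J ≈ 0` happens before the interval absolute value), `ubA`, `VvecLJA`, `linLJA`, ★ `slopeCheckLJA c w J Lc Ln Gs`
  (per-label tubes / remainders / naive labels on the hull box, verbatim `…HomSlopeLJ`), `slopeGsLJA`, `slopeCheckLJA_slopeGsLJA`;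
* §3 ★★★ `slopeLJA_bound_of_check` and ★★★ `forceLJA_ref_bound_of_check`: for every `U` of the entry box,
  `|Σ_b (‖X_b‖⁻⁸ − ‖X_b‖⁻¹⁴)⟪X_b, U(ξ − ξ₀(U))⟫| ≤ (Gs/SC)‖U(ξ − ξ₀(U))‖`, `X_b = latPt U hexFrame b + U(hcpShift + ξ₀(U))` — the `hf₀` input of
  `…HomSlabLeaf.hver_of_slabParts` with the reference shuffle `ξ₀ := affShuf J c U` (proof = `…HomSlopeLJ.slopeLJ_bound_of_check` on the hull box, with the
  first-order step re-arranged by `aff_rearrange`).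

Kernel definitions + soundness; 0 sorry; standard axioms; no instances / notation / `#eval`.  `--supports stmt-AtomisticToContinuum-27623`.
-/

noncomputable section

namespace Summit.AtomisticToContinuum.Crystallization.Theorems.FrustratedLawDichotomyStrainedPatchHomSlopeLJAffine

open scoped BigOperators RealInnerProductSpace
open Literature.Analysis.ValidatedNumerics.Numerics
open Summit.AtomisticToContinuum.Crystallization.Theorems.ChargedEnergyGapNegative (E3)
open Summit.AtomisticToContinuum.Crystallization.Theorems.FrustratedLawDichotomyStrainedPatchHomSplit (latPt hexFrame hcpShift)
open Summit.AtomisticToContinuum.Crystallization.Theorems.FrustratedLawDichotomyStrainedPatchHomCoords (apply_eq_sum_entries)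
open Summit.AtomisticToContinuum.Crystallization.Theorems.FrustratedLawDichotomyStrainedPatchHomEntryGram (entryFI mem_entryFI)
open Summit.AtomisticToContinuum.Crystallization.Theorems.FrustratedLawDichotomyStrainedPatchHomEntryGramHcp (dot3 shufFI mem_dot3 mem_shufFI)
open Summit.AtomisticToContinuum.Crystallization.Theorems.FrustratedLawDichotomyStrainedPatchHomForceKit (vecB mem_vecB)
open Summit.AtomisticToContinuum.Crystallization.Theorems.FrustratedLawDichotomyStrainedPatchHomCurvKit (accFI mem_accFI)
open Summit.AtomisticToContinuum.Crystallization.Theorems.FrustratedLawDichotomyStrainedPatchHomConvexCurvature (segG_zero_eq inner_eq_sum3)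
open Summit.AtomisticToContinuum.Crystallization.Theorems.FrustratedLawDichotomyStrainedPatchHomCurvCentre (pert_rearrange pert_abs_le)
open Summit.AtomisticToContinuum.Crystallization.Theorems.FrustratedLawDichotomyStrainedPatchHomCurvCentreKit
open Summit.AtomisticToContinuum.Crystallization.Theorems.FrustratedLawDichotomyStrainedPatchHomCurvRegime3
open Summit.AtomisticToContinuum.Crystallization.Theorems.FrustratedLawDichotomyStrainedPatchHomSlopeLeafC (abs_sum_mul_le_sqrtHi H0r linSlope_eq)
open Summit.AtomisticToContinuum.Crystallization.Theorems.FrustratedLawDichotomyStrainedPatchHomCurvLJ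
  (betaLJ_eq_profile A0lj B0lj naiveLJ mem_naiveLJ)
open Summit.AtomisticToContinuum.Crystallization.Theorems.FrustratedLawDichotomyStrainedPatchHomSlopeLJ
open Summit.AtomisticToContinuum.Crystallization.Theorems.FrustratedLawDichotomyStrainedPatchHomForceRing (segG_ljProfile_zero)
open Summit.AtomisticToContinuum.Crystallization.Theorems.FrustratedLawDichotomyStrainedPatchTaylorChord (segR segG)
open Summit.AtomisticToContinuum.Crystallization.Theorems.FrustratedLawDichotomyStrainedPatchHomLatticeBoxHcp (norm_shifted_gt)

/-! ## §1. The affine reference shuffle, its hull box, and the shift decomposition -/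

/-- ★ THE AFFINE (sheet-tracking) REFERENCE SHUFFLE: `ξ₀(U)_m = c_m/SC + Σ_k Σ_l (J_m,(k,l)/SC)·(U_kl − c_kl/SC)` (`U_kl = (U e_l)_k`). -/
def affShuf (J : Fin 3 → Fin 3 × Fin 3 → ℤ) (c : (Fin 3 × Fin 3) ⊕ Fin 3 → ℤ) (U : E3 →L[ℝ] E3) : E3 :=
  (EuclideanSpace.equiv (Fin 3) ℝ).symm fun m => (c (Sum.inr m) : ℝ) / SC +
    ∑ k : Fin 3, ∑ l : Fin 3, (J m (k, l) : ℝ) / SC * ((U (EuclideanSpace.single l (1 : ℝ))) k - (c (Sum.inl (k, l)) : ℝ) / SC)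

/-- Components of the affine reference. [formal bookkeeping] -/
theorem affShuf_apply (J : Fin 3 → Fin 3 × Fin 3 → ℤ) (c : (Fin 3 × Fin 3) ⊕ Fin 3 → ℤ) (U : E3 →L[ℝ] E3) (m : Fin 3) :
    affShuf J c U m = (c (Sum.inr m) : ℝ) / SC +
      ∑ k : Fin 3, ∑ l : Fin 3, (J m (k, l) : ℝ) / SC * ((U (EuclideanSpace.single l (1 : ℝ))) k - (c (Sum.inl (k, l)) : ℝ) / SC) := rfl

/-- Scaled half-width of the affine reference in `ξ_m` over the entry box: `⌈Σ_kl |J_m,kl|·w_kl / SC⌉`. -/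
def jw (J : Fin 3 → Fin 3 × Fin 3 → ℤ) (w : (Fin 3 × Fin 3) ⊕ Fin 3 → ℤ) (m : Fin 3) : ℤ :=
  cdiv (∑ k : Fin 3, ∑ l : Fin 3, |J m (k, l)| * w (Sum.inl (k, l))) SC
/-- THE HULL BOX of the affine graph over the entry box: entry half-widths `w`, shuffle half-widths `jw`. -/
def hullW (J : Fin 3 → Fin 3 × Fin 3 → ℤ) (w : (Fin 3 × Fin 3) ⊕ Fin 3 → ℤ) : (Fin 3 × Fin 3) ⊕ Fin 3 → ℤ :=
  Sum.elim (fun ab => w (Sum.inl ab)) fun m => jw J w m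
/-- `hullW` keeps the entry half-widths. [formal bookkeeping] -/
theorem hullW_inl (J : Fin 3 → Fin 3 × Fin 3 → ℤ) (w : (Fin 3 × Fin 3) ⊕ Fin 3 → ℤ) (ab : Fin 3 × Fin 3) : hullW J w (Sum.inl ab) = w (Sum.inl ab) := rfl
/-- `hullW` shuffle half-widths. [formal bookkeeping] -/
theorem hullW_inr (J : Fin 3 → Fin 3 × Fin 3 → ℤ) (w : (Fin 3 × Fin 3) ⊕ Fin 3 → ℤ) (m : Fin 3) : hullW J w (Sum.inr m) = jw J w m := rfl

/-- ★ **The affine graph lies in the hull**: `|ξ₀(U)_m − c_m/SC| ≤ jw_m/SC` for every `U` of the entry box. [folklore] -/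
theorem abs_affShuf_sub_le {J : Fin 3 → Fin 3 × Fin 3 → ℤ} {c w : (Fin 3 × Fin 3) ⊕ Fin 3 → ℤ} (U : E3 →L[ℝ] E3)
    (hbox : ∀ ab : Fin 3 × Fin 3, |(U (EuclideanSpace.single ab.2 (1 : ℝ))) ab.1 - (c (Sum.inl ab) : ℝ) / SC| ≤ (w (Sum.inl ab) : ℝ) / SC) (m : Fin 3) :
    |affShuf J c U m - (c (Sum.inr m) : ℝ) / SC| ≤ (jw J w m : ℝ) / SC := by
  have hS : (0 : ℝ) < SC := by norm_num [SC]
  rw [affShuf_apply, add_sub_cancel_left]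
  have h1 : |∑ k : Fin 3, ∑ l : Fin 3, (J m (k, l) : ℝ) / SC * ((U (EuclideanSpace.single l (1 : ℝ))) k - (c (Sum.inl (k, l)) : ℝ) / SC)| ≤
      ∑ k : Fin 3, ∑ l : Fin 3, (|(J m (k, l) : ℝ)| / SC) * ((w (Sum.inl (k, l)) : ℝ) / SC) := by
    refine (Finset.abs_sum_le_sum_abs _ _).trans (Finset.sum_le_sum fun k _ => ?_)
    refine (Finset.abs_sum_le_sum_abs _ _).trans (Finset.sum_le_sum fun l _ => ?_)
    rw [abs_mul, abs_div, abs_of_pos hS]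
    exact mul_le_mul_of_nonneg_left (hbox (k, l)) (by positivity)
  refine h1.trans ?_
  have hcd := div_le_cdiv (a := ∑ k : Fin 3, ∑ l : Fin 3, |J m (k, l)| * w (Sum.inl (k, l))) (b := (SC : ℤ)) (by exact_mod_cast hS)
  have e : ∑ k : Fin 3, ∑ l : Fin 3, (|(J m (k, l) : ℝ)| / SC) * ((w (Sum.inl (k, l)) : ℝ) / SC) =
      ((∑ k : Fin 3, ∑ l : Fin 3, |J m (k, l)| * w (Sum.inl (k, l)) : ℤ) : ℝ) / (SC : ℤ) / SC := by
    push_cast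
    rw [Finset.sum_div, Finset.sum_div]
    refine Finset.sum_congr rfl fun k _ => ?_
    rw [Finset.sum_div, Finset.sum_div]
    refine Finset.sum_congr rfl fun l _ => ?_
    ring
  rw [e, jw]
  exact div_le_div_of_nonneg_right (by exact_mod_cast hcd) hS.le

/-- The affine graph lies in the shuffle box of the hull. [formal bookkeeping] -/
theorem affShuf_mem_hull {J : Fin 3 → Fin 3 × Fin 3 → ℤ} {c w : (Fin 3 × Fin 3) ⊕ Fin 3 → ℤ} (U : E3 →L[ℝ] E3)
    (hbox : ∀ ab : Fin 3 × Fin 3, |(U (EuclideanSpace.single ab.2 (1 : ℝ))) ab.1 - (c (Sum.inl ab) : ℝ) / SC| ≤ (w (Sum.inl ab) : ℝ) / SC) (m : Fin 3) :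
    |affShuf J c U m - (c (Sum.inr m) : ℝ) / SC| ≤ (hullW J w (Sum.inr m) : ℝ) / SC := by
  rw [hullW_inr]; exact abs_affShuf_sub_le U hbox m

/-- The entry box of the hull is the entry box. [formal bookkeeping] -/
theorem hbox_hull {J : Fin 3 → Fin 3 × Fin 3 → ℤ} {c w : (Fin 3 × Fin 3) ⊕ Fin 3 → ℤ} (U : E3 →L[ℝ] E3)
    (hbox : ∀ ab : Fin 3 × Fin 3, |(U (EuclideanSpace.single ab.2 (1 : ℝ))) ab.1 - (c (Sum.inl ab) : ℝ) / SC| ≤ (w (Sum.inl ab) : ℝ) / SC)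
    (ab : Fin 3 × Fin 3) : |(U (EuclideanSpace.single ab.2 (1 : ℝ))) ab.1 - (c (Sum.inl ab) : ℝ) / SC| ≤ (hullW J w (Sum.inl ab) : ℝ) / SC := by
  rw [hullW_inl]; exact hbox ab

/-- The real `D_kl`-coefficient `Σ_m (c_km/SC)(J_m,kl/SC)` of the centre-transported shift `(U_c(ξ₀(U) − ξ_c))_k`. -/
def cJr (c : (Fin 3 × Fin 3) ⊕ Fin 3 → ℤ) (J : Fin 3 → Fin 3 × Fin 3 → ℤ) (k : Fin 3) (ab : Fin 3 × Fin 3) : ℝ :=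
  ∑ m : Fin 3, (c (Sum.inl (k, m)) : ℝ) / SC * ((J m ab : ℝ) / SC)
/-- Its kernel enclosure. -/
def cJ (c : (Fin 3 × Fin 3) ⊕ Fin 3 → ℤ) (J : Fin 3 → Fin 3 × Fin 3 → ℤ) (k : Fin 3) (ab : Fin 3 × Fin 3) : FI :=
  (((FI.ofScaled (c (Sum.inl (k, 0)))).mul (FI.ofScaled (J 0 ab))).add ((FI.ofScaled (c (Sum.inl (k, 1)))).mul (FI.ofScaled (J 1 ab)))).add
    ((FI.ofScaled (c (Sum.inl (k, 2)))).mul (FI.ofScaled (J 2 ab)))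
/-- ★ `cJ` encloses `cJr`. [folklore] -/
theorem mem_cJ (c : (Fin 3 × Fin 3) ⊕ Fin 3 → ℤ) (J : Fin 3 → Fin 3 × Fin 3 → ℤ) (k : Fin 3) (ab : Fin 3 × Fin 3) : FI.mem (cJr c J k ab) (cJ c J k ab) := by
  unfold cJr cJ
  rw [Fin.sum_univ_three]
  exact FI.mem_add (FI.mem_add (FI.mem_mul (FI.mem_ofScaled _) (FI.mem_ofScaled _)) (FI.mem_mul (FI.mem_ofScaled _) (FI.mem_ofScaled _)))
    (FI.mem_mul (FI.mem_ofScaled _) (FI.mem_ofScaled _))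

/-- Scaled bound of the second-order shift residual: `ubA_k = ⌈Σ_m w_km·jw_m / SC⌉`. -/
def ubA (J : Fin 3 → Fin 3 × Fin 3 → ℤ) (w : (Fin 3 × Fin 3) ⊕ Fin 3 → ℤ) (k : Fin 3) : ℤ := cdiv (∑ m : Fin 3, w (Sum.inl (k, m)) * jw J w m) SC

/-- ★ **SHIFT DECOMPOSITION ALONG THE AFFINE REFERENCE**: `(U(ξ₀(U) − ξ_c))_k = Σ_k' Σ_l D_k'l·cJr_k,(k',l) + s_k` with `|s_k|·SC ≤ ubA_k`
(`s_k = Σ_m D_km (ξ₀(U) − ξ_c)_m`, second order in the cell width). [folklore] -/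
theorem shift_affine_decomp {J : Fin 3 → Fin 3 × Fin 3 → ℤ} {c w : (Fin 3 × Fin 3) ⊕ Fin 3 → ℤ} (U : E3 →L[ℝ] E3)
    (hbox : ∀ ab : Fin 3 × Fin 3, |(U (EuclideanSpace.single ab.2 (1 : ℝ))) ab.1 - (c (Sum.inl ab) : ℝ) / SC| ≤ (w (Sum.inl ab) : ℝ) / SC) (k : Fin 3) :
    ∃ s : ℝ, (U (affShuf J c U - cenShuf c)) k =
        ∑ k' : Fin 3, ∑ l : Fin 3, ((U (EuclideanSpace.single l (1 : ℝ))) k' - (c (Sum.inl (k', l)) : ℝ) / SC) * cJr c J k (k', l) + s ∧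
      |s| * SC ≤ (ubA J w k : ℝ) := by
  have hS : (0 : ℝ) < SC := by norm_num [SC]
  set Jd : Fin 3 → ℝ := fun m => (affShuf J c U - cenShuf c) m with hJd
  have hJd : ∀ m, Jd m = ∑ k' : Fin 3, ∑ l : Fin 3, (J m (k', l) : ℝ) / SC * ((U (EuclideanSpace.single l (1 : ℝ))) k' - (c (Sum.inl (k', l)) : ℝ) / SC) := by
    intro m; rw [hJd]; simp only []; rw [PiLp.sub_apply, affShuf_apply, cenShuf_apply]; ring
  have hJdabs : ∀ m, |Jd m| ≤ (jw J w m : ℝ) / SC := by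
    intro m
    have := abs_affShuf_sub_le (J := J) U hbox m
    rwa [← cenShuf_apply c m, ← PiLp.sub_apply] at this
  refine ⟨∑ m : Fin 3, ((U (EuclideanSpace.single m (1 : ℝ))) k - (c (Sum.inl (k, m)) : ℝ) / SC) * Jd m, ?_, ?_⟩
  · rw [apply_eq_sum_entries U (affShuf J c U - cenShuf c) k]
    have e1 : ∑ m : Fin 3, (U (EuclideanSpace.single m (1 : ℝ))) k * (affShuf J c U - cenShuf c) m =
        ∑ m : Fin 3, (c (Sum.inl (k, m)) : ℝ) / SC * Jd m + ∑ m : Fin 3, ((U (EuclideanSpace.single m (1 : ℝ))) k - (c (Sum.inl (k, m)) : ℝ) / SC) * Jd m := by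
      rw [← Finset.sum_add_distrib]
      exact Finset.sum_congr rfl fun m _ => by
        have e0 : (affShuf J c U - cenShuf c) m = Jd m := rfl
        rw [e0]; ring
    rw [e1]
    congr 1
    -- `Σ_m (c_km/SC) Jd_m = Σ_k'l D_k'l cJr_k,(k'l)`
    simp only [hJd, cJr, Finset.mul_sum]
    rw [Finset.sum_comm]
    refine Finset.sum_congr rfl fun k' _ => ?_
    rw [Finset.sum_comm]
    exact Finset.sum_congr rfl fun l _ => Finset.sum_congr rfl fun m _ => by ring
  · have h1 : |∑ m : Fin 3, ((U (EuclideanSpace.single m (1 : ℝ))) k - (c (Sum.inl (k, m)) : ℝ) / SC) * Jd m| ≤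
        ∑ m : Fin 3, (w (Sum.inl (k, m)) : ℝ) / SC * ((jw J w m : ℝ) / SC) := by
      refine (Finset.abs_sum_le_sum_abs _ _).trans (Finset.sum_le_sum fun m _ => ?_)
      rw [abs_mul]
      exact mul_le_mul (hbox (k, m)) (hJdabs m) (abs_nonneg _) ((abs_nonneg _).trans (hbox (k, m)))
    have hcd := div_le_cdiv (a := ∑ m : Fin 3, w (Sum.inl (k, m)) * jw J w m) (b := (SC : ℤ)) (by exact_mod_cast hS)
    have e : (∑ m : Fin 3, (w (Sum.inl (k, m)) : ℝ) / SC * ((jw J w m : ℝ) / SC)) * SC =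
        ((∑ m : Fin 3, w (Sum.inl (k, m)) * jw J w m : ℤ) : ℝ) / (SC : ℤ) := by
      push_cast
      rw [Finset.sum_mul, Finset.sum_div]
      exact Finset.sum_congr rfl fun m _ => by field_simp
    calc |∑ m : Fin 3, ((U (EuclideanSpace.single m (1 : ℝ))) k - (c (Sum.inl (k, m)) : ℝ) / SC) * Jd m| * SC
        ≤ (∑ m : Fin 3, (w (Sum.inl (k, m)) : ℝ) / SC * ((jw J w m : ℝ) / SC)) * SC := mul_le_mul_of_nonneg_right h1 hS.le
      _ = _ := e
      _ ≤ (ubA J w k : ℝ) := by rw [ubA]; exact_mod_cast hcd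

/-- Re-arrangement of the first-order term along the affine reference. [arithmetic] -/
theorem aff_rearrange (dU M : Fin 3 → Fin 3 → ℝ) (C : Fin 3 → Fin 3 × Fin 3 → ℝ) (s N : Fin 3 → ℝ) :
    ∑ k : Fin 3, ∑ l : Fin 3, dU k l * M k l + ∑ k : Fin 3, (∑ k' : Fin 3, ∑ l : Fin 3, dU k' l * C k (k', l) + s k) * N k =
      ∑ k : Fin 3, ∑ l : Fin 3, dU k l * (M k l + ∑ k'' : Fin 3, C k'' (k, l) * N k'') + ∑ k : Fin 3, s k * N k := by
  simp only [Fin.sum_univ_three]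
  ring

/-! ## §2. The kernel arrays and the Boolean -/

/-- First-order array along the affine reference: `MA_kl,i = Σ_b [h⁰_b,ki (w_b)_l + Σ_k' cJ_k',(k,l) h⁰_b,k'i]` (LJ). -/
def MarrLJA (c : (Fin 3 × Fin 3) ⊕ Fin 3 → ℤ) (J : Fin 3 → Fin 3 × Fin 3 → ℤ) (Lc : List (Fin 3 → ℤ)) (k l i : Fin 3) : FI :=
  accFI Lc fun b => ((H0LJ c b k i).mul (wVec c b l)).add
    ((((cJ c J 0 (k, l)).mul (H0LJ c b 0 i)).add ((cJ c J 1 (k, l)).mul (H0LJ c b 1 i))).add ((cJ c J 2 (k, l)).mul (H0LJ c b 2 i)))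

/-- Scaled componentwise bound of the first-order term along the affine reference (LJ). -/
def VvecLJA (c w : (Fin 3 × Fin 3) ⊕ Fin 3 → ℤ) (J : Fin 3 → Fin 3 × Fin 3 → ℤ) (Lc : List (Fin 3 → ℤ)) (i : Fin 3) : ℤ :=
  cdiv (∑ k : Fin 3, ∑ l : Fin 3, w (Sum.inl (k, l)) * (MarrLJA c J Lc k l i).absHi + ∑ k : Fin 3, ubA J w k * (NarrLJ c Lc k i).absHi) SC
/-- Scaled `ℓ²` bound of the first-order term along the affine reference (LJ). -/
def linLJA (c w : (Fin 3 × Fin 3) ⊕ Fin 3 → ℤ) (J : Fin 3 → Fin 3 × Fin 3 → ℤ) (Lc : List (Fin 3 → ℤ)) : ℤ :=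
  (FI.sqrt ⟨0, cdiv (∑ i : Fin 3, VvecLJA c w J Lc i ^ 2) SC⟩).hi
/-- ★ **THE AFFINE CENTRED LJ SLOPE CHECK** over the entry box `(c, w)` along `ξ₀(U)`: per-label tubes, remainders and naive labels on the hull box,
first-order term combined with `J`, bound `Gs/SC`. -/
def slopeCheckLJA (c w : (Fin 3 × Fin 3) ⊕ Fin 3 → ℤ) (J : Fin 3 → Fin 3 × Fin 3 → ℤ) (Lc Ln : List (Fin 3 → ℤ)) (Gs : ℤ) : Bool :=
  (Lc.all fun b => slopeLJLabelOK c (hullW J w) b) && (Ln.all fun b => (naiveLJ c (hullW J w) b).isSome) &&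
    decide (g0LJ c Lc + linLJA c w J Lc + remSlLJ c (hullW J w) Lc + naiSLJ c (hullW J w) Ln ≤ Gs)

/-- The computed affine LJ slope bound. -/
def slopeGsLJA (c w : (Fin 3 × Fin 3) ⊕ Fin 3 → ℤ) (J : Fin 3 → Fin 3 × Fin 3 → ℤ) (Lc Ln : List (Fin 3 → ℤ)) : ℤ :=
  g0LJ c Lc + linLJA c w J Lc + remSlLJ c (hullW J w) Lc + naiSLJ c (hullW J w) Ln
/-- `slopeCheckLJA` passes at the computed bound, given the guards. [formal bookkeeping] -/
theorem slopeCheckLJA_slopeGsLJA {c w : (Fin 3 × Fin 3) ⊕ Fin 3 → ℤ} {J : Fin 3 → Fin 3 × Fin 3 → ℤ} {Lc Ln : List (Fin 3 → ℤ)}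
    (hc : (Lc.all fun b => slopeLJLabelOK c (hullW J w) b) = true) (hn : (Ln.all fun b => (naiveLJ c (hullW J w) b).isSome) = true) :
    slopeCheckLJA c w J Lc Ln (slopeGsLJA c w J Lc Ln) = true := by
  unfold slopeCheckLJA slopeGsLJA
  simp only [Bool.and_eq_true, decide_eq_true_eq]
  exact ⟨⟨hc, hn⟩, le_rfl⟩

/-! ## §3. ★★★ Soundness -/

/-- ★★★ **SOUNDNESS OF THE AFFINE LJ SLOPE LEAF** (segment-slope form, reference shuffle `ξ₀ = affShuf J c U`). [folklore chaining; skeleton of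
`…HomSlopeLJ.slopeLJ_bound_of_check` on the hull box, first-order step via `shift_affine_decomp` + `aff_rearrange`] -/
theorem slopeLJA_bound_of_check {c w : (Fin 3 × Fin 3) ⊕ Fin 3 → ℤ} {J : Fin 3 → Fin 3 × Fin 3 → ℤ} {Lc Ln : List (Fin 3 → ℤ)} (hL : (Lc ++ Ln).Nodup)
    {Gs : ℤ} (h : slopeCheckLJA c w J Lc Ln Gs = true) (U : E3 →L[ℝ] E3) (hU : ‖U - 1‖ ≤ 1 / 4)
    (hbox : ∀ ab : Fin 3 × Fin 3, |(U (EuclideanSpace.single ab.2 (1 : ℝ))) ab.1 - (c (Sum.inl ab) : ℝ) / SC| ≤ (w (Sum.inl ab) : ℝ) / SC)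
    (hn₀ : ‖affShuf J c U‖ ≤ 1 / 4) (ξ : E3) :
    |∑ b ∈ (Lc ++ Ln).toFinset, segG (fun x : ℝ => x⁻¹ ^ 7 - x⁻¹ ^ 13) (latPt U hexFrame b + U (hcpShift + affShuf J c U)) (U (ξ - affShuf J c U)) 0| ≤
      (Gs : ℝ) / SC * ‖U (ξ - affShuf J c U)‖ := by
  classical
  have hS : (0 : ℝ) < SC := by norm_num [SC]
  unfold slopeCheckLJA at h
  simp only [Bool.and_eq_true, List.all_eq_true, decide_eq_true_eq] at h
  obtain ⟨⟨hcen, hnai⟩, hsum⟩ := h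
  obtain ⟨hLc, hLn, hdisj⟩ := List.nodup_append.1 hL
  have hdisj' : List.Disjoint Lc Ln := fun a ha hb => hdisj a ha a hb rfl
  set ξ₀ : E3 := affShuf J c U with hξ₀def
  set w' : (Fin 3 × Fin 3) ⊕ Fin 3 → ℤ := hullW J w with hw'
  have hbox' : ∀ ab : Fin 3 × Fin 3, |(U (EuclideanSpace.single ab.2 (1 : ℝ))) ab.1 - (c (Sum.inl ab) : ℝ) / SC| ≤ (w' (Sum.inl ab) : ℝ) / SC :=
    fun ab => hbox_hull U hbox ab
  have hξ₀ : ∀ i : Fin 3, |ξ₀ i - (c (Sum.inr i) : ℝ) / SC| ≤ (w' (Sum.inr i) : ℝ) / SC := fun i => affShuf_mem_hull U hbox i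
  set Δ : E3 := U (ξ - ξ₀) with hΔ
  set cb : (Fin 3 → ℤ) → E3 := fun b => latPt U hexFrame b + U (hcpShift + ξ₀) with hcb
  have hρpos : ∀ b : Fin 3 → ℤ, 0 < ‖cb b‖ := fun b => lt_trans (by norm_num) (norm_shifted_gt hU hn₀ b)
  -- each summand is `betaLJ‖c_b‖·⟪c_b, Δ⟫`
  have hsummand : ∀ b ∈ (Lc ++ Ln).toFinset, segG (fun x : ℝ => x⁻¹ ^ 7 - x⁻¹ ^ 13) (cb b) Δ 0 = betaLJ ‖cb b‖ * ⟪cb b, Δ⟫ := by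
    intro b _; rw [segG_zero_eq, betaLJ_eq_profile (hρpos b).ne']
  rw [Finset.sum_congr rfl hsummand, List.toFinset_append, Finset.sum_union (List.disjoint_toFinset_iff_disjoint.2 hdisj')]
  -- NAIVE part (on the hull box)
  have hCn : ∀ (b : Fin 3 → ℤ) (a : Fin 3), FI.mem (cb b a) (vecB (boxE c w') (shufFI c w') b a) :=
    fun b a => mem_vecB U ξ₀ (fun ab => mem_entryFI (hbox' ab)) (fun i => mem_shufFI (hξ₀ i)) b a
  have hQn : ∀ b : Fin 3 → ℤ, FI.mem (‖cb b‖ ^ 2) (dot3 (vecB (boxE c w') (shufFI c w') b) (vecB (boxE c w') (shufFI c w') b)) := by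
    intro b; rw [← real_inner_self_eq_norm_sq]; exact mem_dot3 (hCn b) (hCn b)
  have hβn : ∀ b ∈ Ln, FI.mem (betaLJ ‖cb b‖) ((naiveLJ c w' b).getD (FI.ofInt 0, FI.ofInt 0)).2 := by
    intro b hb
    obtain ⟨AB, hAB⟩ := Option.isSome_iff_exists.1 (hnai b hb)
    have := (mem_naiveLJ hAB (hQn b)).2
    rw [hAB]; simpa using this
  have hNai : |∑ b ∈ Ln.toFinset, betaLJ ‖cb b‖ * ⟪cb b, Δ⟫| ≤ (naiSLJ c w' Ln : ℝ) / SC * ‖Δ‖ := by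
    have hre : ∑ b ∈ Ln.toFinset, betaLJ ‖cb b‖ * ⟪cb b, Δ⟫ = ∑ i, (∑ b ∈ Ln.toFinset, betaLJ ‖cb b‖ * cb b i) * Δ i := by
      calc ∑ b ∈ Ln.toFinset, betaLJ ‖cb b‖ * ⟪cb b, Δ⟫ = ∑ b ∈ Ln.toFinset, ∑ i, betaLJ ‖cb b‖ * cb b i * Δ i := by
            refine Finset.sum_congr rfl fun b _ => ?_
            rw [inner_eq_sum3, Finset.mul_sum]; exact Finset.sum_congr rfl fun i _ => by ring
        _ = ∑ i, ∑ b ∈ Ln.toFinset, betaLJ ‖cb b‖ * cb b i * Δ i := Finset.sum_comm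
        _ = ∑ i, (∑ b ∈ Ln.toFinset, betaLJ ‖cb b‖ * cb b i) * Δ i := Finset.sum_congr rfl fun i _ => by rw [Finset.sum_mul]
    rw [hre]
    refine abs_sum_mul_le_sqrtHi _ Δ (fun i => (GnLJ c w' Ln i).absHi) fun i => ?_
    exact FI.abs_le_absHi (mem_accFI Ln hLn fun b hb => FI.mem_mul (hβn b hb) (hCn b i))
  -- CENTRED part (per-label estimate on the hull box)
  have hlf := fun b (hb : b ∈ Lc) => label_slope_LJ_of_ok (hcen b hb) U hbox' ξ₀ hξ₀ Δ
  set pc : (Fin 3 → ℤ) → E3 := fun b => cenPt c b with hpc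
  have hG0 : |∑ b ∈ Lc.toFinset, betaLJ ‖pc b‖ * ⟪pc b, Δ⟫| ≤ (g0LJ c Lc : ℝ) / SC * ‖Δ‖ := by
    have hre : ∑ b ∈ Lc.toFinset, betaLJ ‖pc b‖ * ⟪pc b, Δ⟫ = ∑ i, (∑ b ∈ Lc.toFinset, betaLJ ‖pc b‖ * pc b i) * Δ i := by
      calc ∑ b ∈ Lc.toFinset, betaLJ ‖pc b‖ * ⟪pc b, Δ⟫ = ∑ b ∈ Lc.toFinset, ∑ i, betaLJ ‖pc b‖ * pc b i * Δ i := by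
            refine Finset.sum_congr rfl fun b _ => ?_
            rw [inner_eq_sum3, Finset.mul_sum]; exact Finset.sum_congr rfl fun i _ => by ring
        _ = ∑ i, ∑ b ∈ Lc.toFinset, betaLJ ‖pc b‖ * pc b i * Δ i := Finset.sum_comm
        _ = ∑ i, (∑ b ∈ Lc.toFinset, betaLJ ‖pc b‖ * pc b i) * Δ i := Finset.sum_congr rfl fun i _ => by rw [Finset.sum_mul]
    rw [hre]
    refine abs_sum_mul_le_sqrtHi _ Δ (fun i => (G0LJ c Lc i).absHi) fun i => ?_
    exact FI.abs_le_absHi (mem_accFI Lc hLc fun b hb => FI.mem_mul (hlf b hb).2.1 (mem_cenVec c b i))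
  set X : Fin 3 → ℝ := fun i => ∑ b ∈ Lc.toFinset, ∑ k, (cb b - pc b) k * H0r (alphaLJ ‖pc b‖) (betaLJ ‖pc b‖) (pc b) k i with hX
  have hlin_eq : ∑ b ∈ Lc.toFinset, (alphaLJ ‖pc b‖ * ⟪pc b, cb b - pc b⟫ * ⟪pc b, Δ⟫ + betaLJ ‖pc b‖ * ⟪cb b - pc b, Δ⟫) = ∑ i, X i * Δ i := by
    rw [Finset.sum_congr rfl fun b _ => linSlope_eq (pc b) (cb b - pc b) Δ (alphaLJ ‖pc b‖) (betaLJ ‖pc b‖), Finset.sum_comm]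
    refine Finset.sum_congr rfl fun i _ => ?_
    rw [hX, Finset.sum_mul]
  -- ★ the first-order term along the affine reference
  have hXb : ∀ i, |X i| * SC ≤ (VvecLJA c w J Lc i : ℝ) := by
    intro i
    set Hb : (Fin 3 → ℤ) → Fin 3 → ℝ := fun b k => H0r (alphaLJ ‖pc b‖) (betaLJ ‖pc b‖) (pc b) k i with hHb
    set dU : Fin 3 → Fin 3 → ℝ := fun k l => (U (EuclideanSpace.single l (1 : ℝ))) k - (c (Sum.inl (k, l)) : ℝ) / SC with hdU
    have hd : ∀ (b : Fin 3 → ℤ) (k : Fin 3), (cb b - pc b) k = ∑ l : Fin 3, dU k l * wPt c b l + (U (ξ₀ - cenShuf c)) k :=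
      fun b k => dVec_formula c U ξ₀ b k
    -- `X_i = Σ_kl D_kl M_kl + Σ_k x_k N_k`
    have hre0 : X i = ∑ k, ∑ l, dU k l * (∑ b ∈ Lc.toFinset, wPt c b l * Hb b k) + ∑ k, (U (ξ₀ - cenShuf c)) k * ∑ b ∈ Lc.toFinset, Hb b k := by
      rw [hX]
      simp only []
      rw [Finset.sum_congr rfl fun b _ => Finset.sum_congr rfl fun k _ => by rw [hd b k]]
      exact pert_rearrange Lc.toFinset dU (fun k => (U (ξ₀ - cenShuf c)) k) (fun b l => wPt c b l) Hb
    -- the shift decomposition `x_k = Σ_k'l D_k'l cJr_k,(k'l) + s_k`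
    choose s hs using fun k => shift_affine_decomp (J := J) (c := c) (w := w) U hbox k
    have hx : ∀ k, (U (ξ₀ - cenShuf c)) k = ∑ k' : Fin 3, ∑ l : Fin 3, dU k' l * cJr c J k (k', l) + s k := fun k => (hs k).1
    set G : Fin 3 → Fin 3 → ℝ := fun k l => ∑ b ∈ Lc.toFinset, (wPt c b l * Hb b k + ∑ k'' : Fin 3, cJr c J k'' (k, l) * Hb b k'') with hG
    have hGsplit : ∀ k l, G k l = (∑ b ∈ Lc.toFinset, wPt c b l * Hb b k) + ∑ k'' : Fin 3, cJr c J k'' (k, l) * ∑ b ∈ Lc.toFinset, Hb b k'' := by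
      intro k l
      rw [hG]
      simp only []
      rw [Finset.sum_add_distrib]
      congr 1
      rw [Finset.sum_comm]
      exact Finset.sum_congr rfl fun k'' _ => by rw [Finset.mul_sum]
    have hre1 : ∑ k, (U (ξ₀ - cenShuf c)) k * ∑ b ∈ Lc.toFinset, Hb b k =
        ∑ k, (∑ k' : Fin 3, ∑ l : Fin 3, dU k' l * cJr c J k (k', l) + s k) * ∑ b ∈ Lc.toFinset, Hb b k :=
      Finset.sum_congr rfl fun k _ => by rw [hx k]
    have hre : X i = ∑ k, ∑ l, dU k l * G k l + ∑ k, s k * ∑ b ∈ Lc.toFinset, Hb b k := by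
      rw [hre0, hre1]
      rw [aff_rearrange dU (fun k l => ∑ b ∈ Lc.toFinset, wPt c b l * Hb b k) (fun k ab => cJr c J k ab) s (fun k => ∑ b ∈ Lc.toFinset, Hb b k)]
      congr 1
      exact Finset.sum_congr rfl fun k _ => Finset.sum_congr rfl fun l _ => by rw [hGsplit k l]
    have hM : ∀ k l, FI.mem (G k l) (MarrLJA c J Lc k l i) := by
      intro k l
      refine mem_accFI Lc hLc fun b hb => ?_
      refine FI.mem_add ?_ ?_
      · rw [mul_comm]; exact FI.mem_mul (mem_H0LJ (hlf b hb).1 (hlf b hb).2.1 k i) (mem_wVec c b l)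
      · rw [Fin.sum_univ_three]
        exact FI.mem_add (FI.mem_add (FI.mem_mul (mem_cJ c J 0 (k, l)) (mem_H0LJ (hlf b hb).1 (hlf b hb).2.1 0 i))
          (FI.mem_mul (mem_cJ c J 1 (k, l)) (mem_H0LJ (hlf b hb).1 (hlf b hb).2.1 1 i)))
          (FI.mem_mul (mem_cJ c J 2 (k, l)) (mem_H0LJ (hlf b hb).1 (hlf b hb).2.1 2 i))
    have hN : ∀ k, FI.mem (∑ b ∈ Lc.toFinset, Hb b k) (NarrLJ c Lc k i) := by
      intro k
      exact mem_accFI Lc hLc fun b hb => mem_H0LJ (hlf b hb).1 (hlf b hb).2.1 k i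
    have habs := pert_abs_le dU G (fun k l => (w (Sum.inl (k, l)) : ℝ) / SC) (fun k l => ((MarrLJA c J Lc k l i).absHi : ℝ) / SC) s
      (fun k => ∑ b ∈ Lc.toFinset, Hb b k) (fun k => (ubA J w k : ℝ) / SC) (fun k => ((NarrLJ c Lc k i).absHi : ℝ) / SC)
      (fun k l => hbox (k, l)) (fun k l => by rw [le_div_iff₀ hS]; exact FI.abs_le_absHi (hM k l))
      (fun k => by rw [le_div_iff₀ hS]; exact (hs k).2) (fun k => by rw [le_div_iff₀ hS]; exact FI.abs_le_absHi (hN k))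
    rw [← hre] at habs
    have hsum' : (∑ k : Fin 3, ∑ l : Fin 3, (w (Sum.inl (k, l)) : ℝ) / SC * (((MarrLJA c J Lc k l i).absHi : ℝ) / SC) +
        ∑ k : Fin 3, (ubA J w k : ℝ) / SC * (((NarrLJ c Lc k i).absHi : ℝ) / SC)) * SC =
        ((∑ k : Fin 3, ∑ l : Fin 3, w (Sum.inl (k, l)) * (MarrLJA c J Lc k l i).absHi + ∑ k : Fin 3, ubA J w k * (NarrLJ c Lc k i).absHi : ℤ) : ℝ) / SC := by
      push_cast
      rw [eq_div_iff hS.ne']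
      simp only [add_mul, Finset.sum_mul]
      congr 1
      · exact Finset.sum_congr rfl fun k _ => Finset.sum_congr rfl fun l _ => by field_simp
      · exact Finset.sum_congr rfl fun k _ => by field_simp
    have hcd := div_le_cdiv (a := ∑ k : Fin 3, ∑ l : Fin 3, w (Sum.inl (k, l)) * (MarrLJA c J Lc k l i).absHi +
      ∑ k : Fin 3, ubA J w k * (NarrLJ c Lc k i).absHi) (b := (SC : ℤ)) (by exact_mod_cast hS)
    calc |X i| * SC ≤ _ := mul_le_mul_of_nonneg_right habs hS.le
      _ = _ := hsum'
      _ ≤ (VvecLJA c w J Lc i : ℝ) := by rw [VvecLJA]; exact_mod_cast hcd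
  have hLin : |∑ i, X i * Δ i| ≤ (linLJA c w J Lc : ℝ) / SC * ‖Δ‖ := abs_sum_mul_le_sqrtHi X Δ (fun i => VvecLJA c w J Lc i) hXb
  have hRem : |∑ b ∈ Lc.toFinset, (betaLJ ‖cb b‖ * ⟪cb b, Δ⟫ - betaLJ ‖pc b‖ * ⟪pc b, Δ⟫ -
      (alphaLJ ‖pc b‖ * ⟪pc b, cb b - pc b⟫ * ⟪pc b, Δ⟫ + betaLJ ‖pc b‖ * ⟪cb b - pc b, Δ⟫))| ≤ (remSlLJ c w' Lc : ℝ) / SC * ‖Δ‖ := by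
    refine (Finset.abs_sum_le_sum_abs _ _).trans ?_
    have h1 : ∑ b ∈ Lc.toFinset, |betaLJ ‖cb b‖ * ⟪cb b, Δ⟫ - betaLJ ‖pc b‖ * ⟪pc b, Δ⟫ -
        (alphaLJ ‖pc b‖ * ⟪pc b, cb b - pc b⟫ * ⟪pc b, Δ⟫ + betaLJ ‖pc b‖ * ⟪cb b - pc b, Δ⟫)| ≤
        ∑ b ∈ Lc.toFinset, (KSlLJ c w' b : ℝ) / SC / 2 * ((nd2S2 c w' b : ℝ) / SC) * ‖Δ‖ :=
      Finset.sum_le_sum fun b hb => (hlf b (List.mem_toFinset.1 hb)).2.2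
    refine h1.trans ?_
    rw [← Finset.sum_mul]
    exact mul_le_mul_of_nonneg_right (remSlLJ_sum_le c w' hLc) (norm_nonneg _)
  have hCen : |∑ b ∈ Lc.toFinset, betaLJ ‖cb b‖ * ⟪cb b, Δ⟫| ≤ ((g0LJ c Lc : ℝ) / SC + (linLJA c w J Lc : ℝ) / SC + (remSlLJ c w' Lc : ℝ) / SC) * ‖Δ‖ := by
    have hsplit : ∑ b ∈ Lc.toFinset, betaLJ ‖cb b‖ * ⟪cb b, Δ⟫ =
        ∑ b ∈ Lc.toFinset, betaLJ ‖pc b‖ * ⟪pc b, Δ⟫ +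
        ∑ b ∈ Lc.toFinset, (alphaLJ ‖pc b‖ * ⟪pc b, cb b - pc b⟫ * ⟪pc b, Δ⟫ + betaLJ ‖pc b‖ * ⟪cb b - pc b, Δ⟫) +
        ∑ b ∈ Lc.toFinset, (betaLJ ‖cb b‖ * ⟪cb b, Δ⟫ - betaLJ ‖pc b‖ * ⟪pc b, Δ⟫ -
          (alphaLJ ‖pc b‖ * ⟪pc b, cb b - pc b⟫ * ⟪pc b, Δ⟫ + betaLJ ‖pc b‖ * ⟪cb b - pc b, Δ⟫)) := by
      rw [← Finset.sum_add_distrib, ← Finset.sum_add_distrib]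
      exact Finset.sum_congr rfl fun b _ => by ring
    rw [hsplit, hlin_eq]
    calc |∑ b ∈ Lc.toFinset, betaLJ ‖pc b‖ * ⟪pc b, Δ⟫ + ∑ i, X i * Δ i +
          ∑ b ∈ Lc.toFinset, (betaLJ ‖cb b‖ * ⟪cb b, Δ⟫ - betaLJ ‖pc b‖ * ⟪pc b, Δ⟫ -
            (alphaLJ ‖pc b‖ * ⟪pc b, cb b - pc b⟫ * ⟪pc b, Δ⟫ + betaLJ ‖pc b‖ * ⟪cb b - pc b, Δ⟫))|
        ≤ |∑ b ∈ Lc.toFinset, betaLJ ‖pc b‖ * ⟪pc b, Δ⟫| + |∑ i, X i * Δ i| +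
          |∑ b ∈ Lc.toFinset, (betaLJ ‖cb b‖ * ⟪cb b, Δ⟫ - betaLJ ‖pc b‖ * ⟪pc b, Δ⟫ -
            (alphaLJ ‖pc b‖ * ⟪pc b, cb b - pc b⟫ * ⟪pc b, Δ⟫ + betaLJ ‖pc b‖ * ⟪cb b - pc b, Δ⟫))| := abs_add_three _ _ _
      _ ≤ (g0LJ c Lc : ℝ) / SC * ‖Δ‖ + (linLJA c w J Lc : ℝ) / SC * ‖Δ‖ + (remSlLJ c w' Lc : ℝ) / SC * ‖Δ‖ := by linarith [hG0, hLin, hRem]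
      _ = _ := by ring
  have hGs : (g0LJ c Lc : ℝ) / SC + (linLJA c w J Lc : ℝ) / SC + (remSlLJ c w' Lc : ℝ) / SC + (naiSLJ c w' Ln : ℝ) / SC ≤ (Gs : ℝ) / SC := by
    rw [← add_div, ← add_div, ← add_div]
    refine div_le_div_of_nonneg_right ?_ hS.le
    exact_mod_cast hsum
  have hΔ0 : 0 ≤ ‖Δ‖ := norm_nonneg _
  calc |∑ b ∈ Lc.toFinset, betaLJ ‖cb b‖ * ⟪cb b, Δ⟫ + ∑ b ∈ Ln.toFinset, betaLJ ‖cb b‖ * ⟪cb b, Δ⟫|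
      ≤ |∑ b ∈ Lc.toFinset, betaLJ ‖cb b‖ * ⟪cb b, Δ⟫| + |∑ b ∈ Ln.toFinset, betaLJ ‖cb b‖ * ⟪cb b, Δ⟫| := abs_add_le _ _
    _ ≤ ((g0LJ c Lc : ℝ) / SC + (linLJA c w J Lc : ℝ) / SC + (remSlLJ c w' Lc : ℝ) / SC) * ‖Δ‖ + (naiSLJ c w' Ln : ℝ) / SC * ‖Δ‖ := add_le_add hCen hNai
    _ = ((g0LJ c Lc : ℝ) / SC + (linLJA c w J Lc : ℝ) / SC + (remSlLJ c w' Lc : ℝ) / SC + (naiSLJ c w' Ln : ℝ) / SC) * ‖Δ‖ := by ring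
    _ ≤ (Gs : ℝ) / SC * ‖Δ‖ := mul_le_mul_of_nonneg_right hGs hΔ0

/-- ★★★ **THE REFERENCE FORCE BOUND `f₀` ALONG THE AFFINE REFERENCE, KERNEL FORM**: `|Σ_b (‖X_b‖⁻⁸ − ‖X_b‖⁻¹⁴)⟪X_b, U(ξ − ξ₀(U))⟫| ≤ (Gs/SC)‖U(ξ − ξ₀(U))‖`,
`X_b = latPt U hexFrame b + U(hcpShift + ξ₀(U))` — the `hf₀` input of `…HomSlabLeaf.hver_of_slabParts` with `ξ₀ := affShuf J c U`. [folklore chaining] -/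
theorem forceLJA_ref_bound_of_check {c w : (Fin 3 × Fin 3) ⊕ Fin 3 → ℤ} {J : Fin 3 → Fin 3 × Fin 3 → ℤ} {Lc Ln : List (Fin 3 → ℤ)} (hL : (Lc ++ Ln).Nodup)
    {Gs : ℤ} (h : slopeCheckLJA c w J Lc Ln Gs = true) (U : E3 →L[ℝ] E3) (hU : ‖U - 1‖ ≤ 1 / 4)
    (hbox : ∀ ab : Fin 3 × Fin 3, |(U (EuclideanSpace.single ab.2 (1 : ℝ))) ab.1 - (c (Sum.inl ab) : ℝ) / SC| ≤ (w (Sum.inl ab) : ℝ) / SC)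
    (hn₀ : ‖affShuf J c U‖ ≤ 1 / 4) (ξ : E3) :
    |∑ bb ∈ (Lc ++ Ln).toFinset, (‖latPt U hexFrame bb + U (hcpShift + affShuf J c U)‖⁻¹ ^ 8 - ‖latPt U hexFrame bb + U (hcpShift + affShuf J c U)‖⁻¹ ^ 14) *
        ⟪latPt U hexFrame bb + U (hcpShift + affShuf J c U), U (ξ - affShuf J c U)⟫| ≤ (Gs : ℝ) / SC * ‖U (ξ - affShuf J c U)‖ := by
  have key := slopeLJA_bound_of_check hL h U hU hbox hn₀ ξ
  rw [Finset.sum_congr rfl fun bb _ => segG_ljProfile_zero (latPt U hexFrame bb + U (hcpShift + affShuf J c U)) (U (ξ - affShuf J c U))] at key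
  exact key

end Summit.AtomisticToContinuum.Crystallization.Theorems.FrustratedLawDichotomyStrainedPatchHomSlopeLJAffine

end
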